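import Summits.BirchSwinnertonDyer.Rank1Residual.Additive.GordTwistOrdinary
import Summits.BirchSwinnertonDyer.Rank1Residual.Additive.SemistabilityDefectRamification
import HarnessLib

/-!
# X3♯/X4♯ (G-ord): on EVERY subfield of `ℚ(ζ_p)` over which `E` is good above `p`, a (G)-ordinary pair is good ORDINARY

HONEST FRAMING (cell `b2b-bsdres`, run/shared/lean/b2b/bsd-rank1-residual/, verbatim in every
file): the goal of the cell is to DELETE the COMBINATION-SHAPED residual classes of the
Birch–Swinnerton-Dyer formula for ALL analytic-rank `≤ 1` elliptic curves over `ℚ` — "full BSD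
formula for every rank `≤ 1` curve in class `C`" assembled STRICTLY from published theorems — so
that the rank-`≤ 1` remainder becomes exactly the CONSTRUCTION-SHAPED classes, which are TYPED
(missing-input `Prop`s), NOT attempted. This is not "finishing BSD". Sub-cell `additive-p2`
(CLASS-OWNERS row "X3/X4 additive — pot. good ordinary / X3♯(G-ord)"), generation 5: research
route; no claim beyond the stated classes; theorems only, no definition, no new named fact;
X3♯(G-ord)/X4♯(G-ord) stay CONSTRUCTION-SHAPED.

WHAT THIS FILE DOES. `TypeGOrd W p` (gen 0, `PotGoodOrdinary.lean`: Delbourgo's standing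
hypothesis "(G) + potential good ORDINARY reduction", Compositio Math. 113 (1998) Thm. 3 / Prop. 4
/ Main Conjecture) asks for SOME subfield of SOME `p`-th cyclotomic field over which `E` is good
with the unit-root condition above `p`. This file shows that the unit-root condition is then
AUTOMATIC on EVERY subfield `F` of EVERY `p`-th cyclotomic field at every place `w ∣ p` where `E_F`
is good (`p ≥ 5`, `E` additive at `p`, `W` globally minimal):

* `hasUnitRootAt_of_typeG_of_semistabilityIndex_ne_two` — defect `e_E(p) ∈ {3, 4, 6}`: type (G)
  alone suffices (the reduced curve has `j̃ = 0` resp. `1728` over the residue field `𝔽_p`,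
  `3 ∣ e_E(p) ∣ p − 1` resp. `4 ∣ e_E(p) ∣ p − 1`, Deuring — gen 3's
  `hasUnitRootAt_of_valuation_j_lt_one` / `_j_sub_lt_one`, now for a GIVEN field and place);
  `typeGOrd_of_typeG_of_semistabilityIndex_ne_two` (`TypeG ∧ Addv ∧ e_E(p) ≠ 2 → TypeGOrd`, the
  `CondExpTwo`-free form of gen 3's `typeGOrd_of_addv_of_subGordHigher`).
* `hasUnitRootAt_of_typeGOrd_of_semistabilityIndex_eq_two` — defect `2` (Kodaira `I₀*`): the
  twist `E^{(p*)}` is good ORDINARY over `ℚ` (gen 4's `exists_goodOrd_twist_pStar_of_typeGOrd`);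
  up to a prime `𝔓 ∣ w` of `L` (gen 0's `hasUnitRootAt_baseChange_of_hasGoodReductionAt`), across
  the `L`-isomorphism `E^{(p*)}_L ≅ E_L` (`√p* ∈ L`), and DOWN from `𝔓` to `w` by gen 4's
  `hasUnitRootAt_baseChange_iff_of_hasGoodReductionAt` — the reverse run of gen 4's
  `goodOrd_of_typeGOrd_of_hasGoodReductionAtPrime`.
* `TypeGOrd.hasUnitRootAt_of_hasGoodReductionAt` — both cases: **for a (G)-ordinary additive
  pair, `E_F` good at `w ∣ p` ⟹ `E_F` ordinary at `w`, for every `F ⊆ ℚ(ζ_p)`**;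
  `TypeGOrd.good_and_unitRoot_iff_good` (bookkeeping form).

So "(G)-ordinary" is a property of the pair `(E, p)` read on ANY (G)-field — in particular on the
canonical minimal one of degree `e_E(p)` (sibling files `CyclotomicSubfields.lean`,
`MinimalGoodReductionField.lean`). Located gap / labels / census UNCHANGED
(HOME/b2b-bsdres-additive-p2/AUDIT-X34-GORD.md).

References: D. Delbourgo, Compositio Math. 113 (1998) §1.3, §1.5, Thm. 3, Prop. 4; J. H. Silverman,
*AEC* V.2.3.1, V.4.1, Ex. V.4.4–4.5, VII.5.4; J.-P. Serre, J. Tate, Ann. of Math. 88 (1968) §2.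
-/

noncomputable section

open scoped Classical NumberField

open WeierstrassCurve IsDedekindDomain IsDedekindDomain.HeightOneSpectrum NumberField
  Rat.HeightOneSpectrum Literature.NumberTheory.EllipticCurves
  Literature.NumberTheory.EllipticCurves.Rank1Residual

namespace Summit.BirchSwinnertonDyer.Rank1Residual.Additive

variable (W : WeierstrassCurve ℚ) [W.IsElliptic] [W.IsGloballyMinimal] (p : ℕ) [hp : Fact p.Prime]
  {L : Type} [Field L] [NumberField L] [hcyc : IsCyclotomicExtension {p} ℚ L]
  (F : IntermediateField ℚ L) (w : HeightOneSpectrum (𝓞 F))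

/-! ### Defect `3, 4, 6`: type (G) alone gives ordinary reduction above `p` -/

include hcyc in
/-- **Defect `e_E(p) ∈ {3, 4, 6}`: over any subfield `F ⊆ ℚ(ζ_p)`, good reduction of `E_F` at
`w ∣ p` is ORDINARY** (`p ≥ 5`, `E` additive of type (G) at `p`, `W` globally minimal). From
`e_E(p) ∣ p − 1` (gen 2's `typeG_iff_not_subM_and_semistabilityIndex_dvd`) and `e_E(p) ∤ 4` resp.
`∤ 6`: `3 ∤ ord_p Δ_min` and `3 ∣ p − 1` (resp. `2 ∤ ord_p Δ_min` and `4 ∣ p − 1`), so `j ≡ 0`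
(resp. `1728`) `(mod p)` (gen 3), the residue field of `w` is `𝔽_p`
(`absNorm_eq_of_intermediateField_cyclotomic`), and Deuring's criterion applies
(`hasUnitRootAt_of_valuation_j_lt_one` / `_j_sub_lt_one`). -/
theorem hasUnitRootAt_of_typeG_of_semistabilityIndex_ne_two (hp5 : 5 ≤ p) (hadd : Addv W p)
    (hG : TypeG W p) (hne2 : semistabilityIndex W p ≠ 2) (hw : (p : 𝓞 F) ∈ w.asIdeal)
    (hgood : (W.baseChange F).HasGoodReductionAt w) : (W.baseChange F).HasUnitRootAt w := by
  haveI : NumberField F := NumberField.of_module_finite ℚ F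
  haveI : (W.baseChange F).IsElliptic := by rw [baseChange]; infer_instance
  haveI := liesOver_span_of_natCast_mem p F w hw
  have hj : 0 ≤ padicValRat p W.j := padicValRat_j_nonneg_of_typeG W p hG
  have hdvd : semistabilityIndex W p ∣ p - 1 :=
    ((typeG_iff_not_subM_and_semistabilityIndex_dvd W p hp5).mp hG).2
  have hne1 : semistabilityIndex W p ≠ 1 := semistabilityIndex_ne_one_of_addv W p hp5 hadd hj
  have h12 : semistabilityIndex W p ∣ 12 := semistabilityIndex_dvd_twelve W p
  have hN := absNorm_eq_of_intermediateField_cyclotomic p F w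
  have hjF : (W.baseChange F).j = algebraMap ℚ F W.j := W.map_j (algebraMap ℚ F)
  -- `e ∈ {3, 4, 6, 12}`; split according to `3 ∣ ord_p Δ_min`
  by_cases h3 : 3 ∣ padicValInt p W.minimalDiscriminantInt
  · -- then `e ∣ 4`, so `e = 4`: `2 ∤ ord_p Δ_min`, `j ≡ 1728`, `4 ∣ p − 1`
    have he4 : semistabilityIndex W p ∣ 4 := semistabilityIndex_dvd_four_of_three_dvd W p h3
    have he : semistabilityIndex W p = 4 := by
      have hle := Nat.le_of_dvd (by norm_num) he4
      interval_cases h : semistabilityIndex W p <;> simp_all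
    have h2 : ¬ 2 ∣ padicValInt p W.minimalDiscriminantInt := by
      intro h2
      have h6 := semistabilityIndex_dvd_six_of_two_dvd W p h2
      rw [he] at h6
      norm_num at h6
    have h4 : 4 ∣ p - 1 := by rw [← he]; exact hdvd
    have hj' := j_eq_or_padicValRat_j_sub_pos_of_not_two_dvd W p hp5 hj h2
    have hjF' : (W.baseChange F).j - 1728 = algebraMap ℚ F (W.j - 1728) := by
      rw [map_sub, hjF, map_ofNat]
    refine hasUnitRootAt_of_valuation_j_sub_lt_one (W.baseChange F) w hp.out hp5 h4 hw hN hgood ?_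
    rw [hjF']
    refine valuation_algebraMap_lt_one_of_padicValRat_pos p w hw ?_
    rcases hj' with h | h
    · left; rw [h, sub_self]
    · right; exact h
  · -- `3 ∤ ord_p Δ_min`: `j ≡ 0`; and `3 ∣ e` (else `e ∣ 4`, forcing `3 ∣ v`... ) so `3 ∣ p − 1`
    have hj' := j_eq_zero_or_padicValRat_j_pos_of_not_three_dvd W p hj h3
    -- `e ∈ {3, 6, 12}`: `e ∣ 12`, `e ≠ 1, 2, 4` (`e = 4` would need `gcd = 3 ∣ v`)
    have h3e : 3 ∣ semistabilityIndex W p := by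
      -- `e·gcd(12,v) = 12`; if `3 ∤ e` then `3 ∣ gcd(12, v) ∣ v`
      by_contra h3e
      have hg : semistabilityIndex W p * Nat.gcd 12 (padicValInt p W.minimalDiscriminantInt) = 12 :=
        Nat.div_mul_cancel (Nat.gcd_dvd_left 12 _)
      have h3g : 3 ∣ Nat.gcd 12 (padicValInt p W.minimalDiscriminantInt) := by
        have h312 : (3 : ℕ) ∣ semistabilityIndex W p *
            Nat.gcd 12 (padicValInt p W.minimalDiscriminantInt) := by rw [hg]; norm_num
        exact (Nat.Prime.dvd_mul Nat.prime_three).mp h312 |>.resolve_left h3e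
      exact h3 (dvd_trans h3g (Nat.gcd_dvd_right 12 _))
    have h3p : 3 ∣ p - 1 := dvd_trans h3e hdvd
    refine hasUnitRootAt_of_valuation_j_lt_one (W.baseChange F) w hp.out hp5 h3p hw hN hgood ?_
    rw [hjF]
    exact valuation_algebraMap_lt_one_of_padicValRat_pos p w hw hj'

include hcyc in
/-- **`TypeG ∧ Addv ∧ e_E(p) ≠ 2 → TypeGOrd`** (`p ≥ 5`, `W` globally minimal): on the defect-`3,4,6`
cell type (G) is already (G)-ORDINARY — the `CondExpTwo`-free form of gen 3's
`typeGOrd_of_addv_of_subGordHigher`. (The cyclotomic field `L` of the statement only fixes where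
the witness lives; any `L` works.) -/
theorem typeGOrd_of_typeG_of_semistabilityIndex_ne_two (hp5 : 5 ≤ p) (hadd : Addv W p)
    (hG : TypeG W p) (hne2 : semistabilityIndex W p ≠ 2)
    (F : IntermediateField ℚ L)
    (hF : ∀ w : HeightOneSpectrum (𝓞 F), (p : 𝓞 F) ∈ w.asIdeal →
      (W.baseChange F).HasGoodReductionAt w) : TypeGOrd W p :=
  ⟨L, inferInstance, inferInstance, hcyc, F, fun w hw ↦ ⟨hF w hw,
    hasUnitRootAt_of_typeG_of_semistabilityIndex_ne_two W p F w hp5 hadd hG hne2 hw (hF w hw)⟩⟩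

/-! ### Defect `2`: (G)-ordinary gives ordinary reduction on every (G)-field -/

include hcyc in
/-- **Defect `e_E(p) = 2`: over any subfield `F ⊆ ℚ(ζ_p)`, good reduction of `E_F` at `w ∣ p` is
ORDINARY when `(E, p)` is (G)-ordinary** (`p ≥ 5`, `W` globally minimal). The twist `E^{(p*)}` has a
globally minimal model `Wd` good ORDINARY at `p` (gen 4's `exists_goodOrd_twist_pStar_of_typeGOrd`);
for a prime `𝔓 ∣ w` of `L`: `Wd_L` is ordinary at `𝔓` (gen 0, up from `ℚ`), `Wd_L ≅ W_L`
(`√p* ∈ L`, `exists_sq_eq_pStar`), so `W_L` is ordinary at `𝔓`, and ordinarity DESCENDS from `𝔓`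
to `w` along `L/F` because `E_F` is good at `w` (gen 4's
`hasUnitRootAt_baseChange_iff_of_hasGoodReductionAt`). -/
theorem hasUnitRootAt_of_typeGOrd_of_semistabilityIndex_eq_two (hp5 : 5 ≤ p) (hG : TypeGOrd W p)
    (he : semistabilityIndex W p = 2) (hw : (p : 𝓞 F) ∈ w.asIdeal)
    (hgood : (W.baseChange F).HasGoodReductionAt w) : (W.baseChange F).HasUnitRootAt w := by
  have hp2 : p ≠ 2 := by omega
  haveI : NumberField F := NumberField.of_module_finite ℚ F
  haveI : (W.baseChange F).IsElliptic := by rw [baseChange]; infer_instance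
  -- the good ordinary twist over `ℚ`
  obtain ⟨Wd, iWd, iWdmin, C₀, hC₀, hord⟩ := exists_goodOrd_twist_pStar_of_typeGOrd W p hp5 hG he
  -- a prime `𝔓` of `L` above `w`
  haveI := w.isMaximal
  obtain ⟨Q, hQmax, hQover⟩ :=
    Ideal.exists_maximal_ideal_liesOver_of_isIntegral (S := 𝓞 L) w.asIdeal
  set 𝔓 : HeightOneSpectrum (𝓞 L) :=
    ⟨Q, hQmax.isPrime, Ideal.ne_bot_of_liesOver_of_ne_bot w.ne_bot Q⟩ with h𝔓def
  haveI h𝔓w' : 𝔓.asIdeal.LiesOver w.asIdeal := hQover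
  have h𝔓w : 𝔓.asIdeal.under (𝓞 F) = w.asIdeal := hQover.over.symm
  have hp𝔓 : (p : 𝓞 L) ∈ 𝔓.asIdeal := by
    have : (p : 𝓞 F) ∈ 𝔓.asIdeal.under (𝓞 F) := by rw [h𝔓w]; exact hw
    rw [Ideal.under_def, Ideal.mem_comap, map_natCast] at this
    exact this
  -- the place `v` of `ℚ` over `p`
  set v : HeightOneSpectrum (𝓞 ℚ) := (primesEquiv (R := 𝓞 ℚ)).symm ⟨p, hp.out⟩ with hvdef
  have hpv : (p : 𝓞 ℚ) ∈ v.asIdeal :=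
    (natCast_mem_asIdeal_iff_eq_primesEquiv_symm v hp.out).mpr rfl
  have h𝔓v : 𝔓.asIdeal.under (𝓞 ℚ) = v.asIdeal := under_eq_asIdeal_of_natCast_mem p 𝔓 hp𝔓
  -- `Wd_L` good ordinary at `𝔓` (up from `ℚ`)
  have hgDv : Wd.HasGoodReductionAt v := hasGoodReductionAt_of_hasGoodReductionAtPrime p Wd hord.1
  have huDv : Wd.HasUnitRootAt v :=
    (Wd.hasUnitRootAt_iff_not_dvd_frobeniusTrace v hp.out hpv).mpr hord.2
  have huDL : (Wd.baseChange L).HasUnitRootAt 𝔓 :=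
    hasUnitRootAt_baseChange_of_hasGoodReductionAt Wd L p hpv h𝔓v hgDv huDv
  -- `W_L` good at `𝔓` (up from `F`)
  have hWL : (W.baseChange F).baseChange L = W.baseChange L := by
    rw [baseChange, show algebraMap F L = (IsScalarTower.toAlgHom ℚ F L : F →+* L) from rfl]
    exact W.map_baseChange (IsScalarTower.toAlgHom ℚ F L)
  have hgWL : (W.baseChange L).HasGoodReductionAt 𝔓 := by
    rw [← hWL]
    exact hasGoodReductionAt_baseChange_of_hasGoodReductionAt (W.baseChange F) L w 𝔓 hgood
  -- `W_L ≅ Wd_L`: over `L` the twist parameter `p*` is a square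
  set d : ℚ := (-1 : ℚ) ^ (p / 2) * p with hd
  obtain ⟨g, hg⟩ := exists_sq_eq_pStar p L hp2
  have hg2 : (algebraMap ℚ L) d = 1 * g ^ 2 := by
    rw [one_mul, hg, hd, map_mul, map_pow, map_neg, map_one, map_natCast]
  have hg0 : g ≠ 0 := by
    intro h0
    have : (algebraMap ℚ L) d = 0 := by rw [hg2, h0]; simp
    rw [map_eq_zero] at this
    exact (mul_ne_zero (pow_ne_zero _ (by norm_num)) (by exact_mod_cast hp.out.ne_zero)) this
  have htw : (W.quadraticTwist d).baseChange L = (W.baseChange L).quadraticTwist (1 * g ^ 2) := by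
    rw [← hg2]
    exact map_quadraticTwist W (algebraMap ℚ L) d
  haveI : NeZero (2 : L) := ⟨two_ne_zero⟩
  haveI : (W.baseChange L).IsElliptic := by rw [baseChange]; infer_instance
  obtain ⟨C₁, hC₁⟩ := exists_variableChange_quadraticTwist_one (W.baseChange L)
  obtain ⟨C₂, hC₂⟩ := exists_variableChange_quadraticTwist_mul_sq (W.baseChange L) 1 g hg0
  have hWdL : Wd.baseChange L = (C₀.map (algebraMap ℚ L)) • (W.quadraticTwist d).baseChange L := by
    rw [← hC₀, baseChange, baseChange, ← map_variableChange]
  have hiso : (C₀.map (algebraMap ℚ L) * (C₂ * C₁)) • W.baseChange L = Wd.baseChange L := by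
    rw [mul_smul, mul_smul, hC₁, hC₂, ← htw, hWdL]
  -- transport ordinarity from `Wd_L` to `W_L` at `𝔓`
  have huWL : (W.baseChange L).HasUnitRootAt 𝔓 := by
    rw [← hiso] at huDL
    exact (hasUnitRootAt_smul_iff (W.baseChange L) (C₀.map (algebraMap ℚ L) * (C₂ * C₁)) 𝔓
      hgWL).mp huDL
  -- down from `𝔓` to `w`
  rw [← hWL] at huWL
  exact (hasUnitRootAt_baseChange_iff_of_hasGoodReductionAt (W.baseChange F) L p hw h𝔓w
    hgood).mp huWL

/-! ### Both cases -/

include hcyc in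
/-- **On every (G)-field a (G)-ordinary additive pair is good ORDINARY** (`p ≥ 5`, `W` globally
minimal): `TypeGOrd W p`, `Addv W p`, `F ⊆ ℚ(ζ_p)` any subfield, `w ∣ p`, `E_F` good at `w` ⟹
`E_F` satisfies the unit-root condition at `w`. -/
theorem TypeGOrd.hasUnitRootAt_of_hasGoodReductionAt (hp5 : 5 ≤ p) (hG : TypeGOrd W p)
    (hadd : Addv W p) (hw : (p : 𝓞 F) ∈ w.asIdeal)
    (hgood : (W.baseChange F).HasGoodReductionAt w) : (W.baseChange F).HasUnitRootAt w := by
  by_cases he : semistabilityIndex W p = 2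
  · exact hasUnitRootAt_of_typeGOrd_of_semistabilityIndex_eq_two W p F w hp5 hG he hw hgood
  · exact hasUnitRootAt_of_typeG_of_semistabilityIndex_ne_two W p F w hp5 hadd hG.typeG he hw hgood

include hcyc in
/-- Bookkeeping form: for a (G)-ordinary additive pair and any subfield `F ⊆ ℚ(ζ_p)`, "`E_F` good
with unit root at every `w ∣ p`" iff "`E_F` good at every `w ∣ p`". -/
theorem TypeGOrd.forall_good_and_unitRoot_iff_forall_good (hp5 : 5 ≤ p) (hG : TypeGOrd W p)
    (hadd : Addv W p) :
    (∀ w : HeightOneSpectrum (𝓞 F), (p : 𝓞 F) ∈ w.asIdeal →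
        (W.baseChange F).HasGoodReductionAt w ∧ (W.baseChange F).HasUnitRootAt w) ↔
      ∀ w : HeightOneSpectrum (𝓞 F), (p : 𝓞 F) ∈ w.asIdeal →
        (W.baseChange F).HasGoodReductionAt w :=
  ⟨fun h w hw ↦ (h w hw).1, fun h w hw ↦ ⟨h w hw,
    TypeGOrd.hasUnitRootAt_of_hasGoodReductionAt W p F w hp5 hG hadd hw (h w hw)⟩⟩

end Summit.BirchSwinnertonDyer.Rank1Residual.Additive

end
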